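import Summits.AtomisticToContinuum.HydrodynamicLimit.Theorems.CollisionIsometryCLTAdaptedWeightCLTBlockHDissipationB
import Mathlib.InformationTheory.KullbackLeibler.KLFun

/-!
# Per-contact inputs of the line `block-h-dissipation-closure` (crux `AdaptedWeightCLT`,
stmt-AtomisticToContinuum-14868; stub `stub_perContact`, `--supports`) — helper 1: the Bregman calculus of
`a ↦ a log a`

Pure real analysis behind the per-contact Bregman remainder
`S_N(post) − S_N(pre) − incr(pre, post) = ∫ₓ ρ̄ ∫ᵥ breg(f̂_post, f̂_pre)` of the regularised cell entropy
(vocabulary `…Theorems.BlockHDissipation`: `entS`, `incr`, `bregS`). Throughout, the Bregman divergence of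
`a ↦ a log a` is written in the explicit form `breg(a, b) := a (log a − log b) − a + b` (no new definition; the
integrand `a log a − b log b − (1 + log b)(a − b)` of `entS − entS − incr` is this expression, `breg_eq_integrand`):
* `breg(a, b) = b · klFun (a/b)` (`InformationTheory.klFun x = x log x + 1 − x`), hence `≥ 0` (`breg_nonneg`), at most
  the QUADRATIC bound `(a − b)²/b` (`breg_le_sq_div`), positively homogeneous (`breg_smul`), satisfies the
  THREE-POINT IDENTITY `breg(a,b) = breg(a,c) + breg(c,b) + (a − c)(log c − log b)` (`breg_three_point`) and the
  LOG-SUM (joint convexity) inequality `breg(Σ tₖ pₖ, Σ tₖ qₖ) ≤ Σ tₖ breg(pₖ, qₖ)` (`breg_sum_smul_le`, Jensen for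
  the convex `klFun`), with its two-term forms `breg_add_le`, `breg_mix_two_le`;
* the scalar facts used for the Gaussian relative entropies of the co-moving floor:
  `r − 1 − log r ≤ (r − 1)²/r` (`sub_one_sub_log_le`), `≤ 2 (r − 1)²` for `r ≥ 1/2`, `≤ |s₁ − s₀| / min s₀ s₁`
  for `r = s₁/s₀` (nonnegativity is the tree's `Literature.MathematicalPhysics.KineticTheory.sub_one_sub_log_nonneg`,
  `|log(1 + x)| ≤ 2|x|` the tree's `MaxwellianSecondOrder.abs_log_one_add_le`).
-/

namespace Summit.AtomisticToContinuum.HydrodynamicLimit.Theorems.BlockHDissipation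

open scoped BigOperators
open Real InformationTheory

noncomputable section

namespace PerContact

/-! ## The Bregman divergence of `a log a` -/

/-- The integrand of `entS(post) − entS(pre) − incr(pre, post)` is the Bregman divergence:
`a log a − b log b − (1 + log b)(a − b) = a (log a − log b) − a + b`. -/
theorem breg_eq_integrand (a b : ℝ) :
    a * log a - b * log b - (1 + log b) * (a - b) = a * (log a - log b) - a + b := by
  ring

/-- `breg(a, b) = b · klFun (a / b)` for `a ≥ 0`, `b > 0`. -/
theorem breg_eq_mul_klFun {a b : ℝ} (ha : 0 ≤ a) (hb : 0 < b) :
    a * (log a - log b) - a + b = b * klFun (a / b) := by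
  rw [klFun_apply]
  rcases ha.eq_or_lt with h0 | hpos
  · subst h0; simp
  · rw [log_div hpos.ne' hb.ne']
    field_simp
    ring

/-- NONNEGATIVITY (convexity of `a log a`): `0 ≤ breg(a, b)` for `a ≥ 0`, `b > 0`. -/
theorem breg_nonneg {a b : ℝ} (ha : 0 ≤ a) (hb : 0 < b) : 0 ≤ a * (log a - log b) - a + b := by
  rw [breg_eq_mul_klFun ha hb]
  exact mul_nonneg hb.le (klFun_nonneg (div_nonneg ha hb.le))

/-- QUADRATIC BOUND: `breg(a, b) ≤ (a − b)²/b` for `a ≥ 0`, `b > 0` (from `klFun x ≤ (x − 1)²`, i.e.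
`(1+u) log(1+u) − u ≤ u²` for `u ≥ −1`; tree: `…PosCore.klFun_le_sq_sub_one`, re-derived inline from
`log x ≤ x − 1` to keep the import light). -/
theorem breg_le_sq_div {a b : ℝ} (ha : 0 ≤ a) (hb : 0 < b) : a * (log a - log b) - a + b ≤ (a - b) ^ 2 / b := by
  rw [breg_eq_mul_klFun ha hb]
  have h : klFun (a / b) ≤ (a / b - 1) ^ 2 := by
    rw [klFun_apply]
    rcases (div_nonneg ha hb.le).eq_or_lt with h0 | hpos
    · rw [← h0]; norm_num
    · nlinarith [log_le_sub_one_of_pos hpos, hpos]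
  calc b * klFun (a / b) ≤ b * (a / b - 1) ^ 2 := mul_le_mul_of_nonneg_left h hb.le
    _ = (a - b) ^ 2 / b := by field_simp

/-- THREE-POINT IDENTITY: `breg(a, b) = breg(a, c) + breg(c, b) + (a − c)(log c − log b)`. -/
theorem breg_three_point (a b c : ℝ) :
    a * (log a - log b) - a + b =
      (a * (log a - log c) - a + c) + (c * (log c - log b) - c + b) + (a - c) * (log c - log b) := by
  ring

/-- POSITIVE HOMOGENEITY: `breg(t a, t b) = t · breg(a, b)` for `t, a ≥ 0`, `b > 0`. -/
theorem breg_smul {t a b : ℝ} (ht : 0 ≤ t) (ha : 0 ≤ a) (hb : 0 < b) :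
    t * a * (log (t * a) - log (t * b)) - t * a + t * b = t * (a * (log a - log b) - a + b) := by
  rcases ht.eq_or_lt with h0 | htp
  · subst h0; simp
  rcases ha.eq_or_lt with h0 | hap
  · subst h0; simp
  rw [log_mul htp.ne' hap.ne', log_mul htp.ne' hb.ne']
  ring

/-- LOG-SUM INEQUALITY (joint convexity of the Bregman divergence of `a log a`): for `aₖ ≥ 0`, `bₖ > 0`,
`breg(Σ aₖ, Σ bₖ) ≤ Σ breg(aₖ, bₖ)` (Jensen for the convex function `klFun` with weights `bₖ / Σ b`). -/
theorem breg_sum_le {ι : Type*} (s : Finset ι) {a b : ι → ℝ} (ha : ∀ k ∈ s, 0 ≤ a k)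
    (hb : ∀ k ∈ s, 0 < b k) :
    (∑ k ∈ s, a k) * (log (∑ k ∈ s, a k) - log (∑ k ∈ s, b k)) - (∑ k ∈ s, a k) + ∑ k ∈ s, b k ≤
      ∑ k ∈ s, (a k * (log (a k) - log (b k)) - a k + b k) := by
  rcases s.eq_empty_or_nonempty with hs | hs
  · subst hs; simp
  set A := ∑ k ∈ s, a k with hA
  set B := ∑ k ∈ s, b k with hB
  have hBpos : 0 < B := Finset.sum_pos hb hs
  have hA0 : 0 ≤ A := Finset.sum_nonneg ha
  -- Jensen for `klFun` with weights `b k / B` at the points `a k / b k`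
  have hJ := convexOn_klFun.map_sum_le (t := s) (w := fun k => b k / B) (p := fun k => a k / b k)
    (fun k hk => div_nonneg (hb k hk).le hBpos.le)
    (by rw [← Finset.sum_div, div_self hBpos.ne'])
    (fun k hk => Set.mem_Ici.2 (div_nonneg (ha k hk) (hb k hk).le))
  have hpt : ∑ k ∈ s, (b k / B) • (a k / b k) = A / B := by
    simp only [smul_eq_mul]
    rw [hA, Finset.sum_div]
    exact Finset.sum_congr rfl fun k hk => by field_simp [(hb k hk).ne']
  rw [hpt] at hJ
  simp only [smul_eq_mul] at hJ
  rw [breg_eq_mul_klFun hA0 hBpos]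
  calc B * klFun (A / B) ≤ B * ∑ k ∈ s, b k / B * klFun (a k / b k) := mul_le_mul_of_nonneg_left hJ hBpos.le
    _ = ∑ k ∈ s, b k * klFun (a k / b k) := by
        rw [Finset.mul_sum]
        exact Finset.sum_congr rfl fun k _ => by field_simp
    _ = ∑ k ∈ s, (a k * (log (a k) - log (b k)) - a k + b k) :=
        Finset.sum_congr rfl fun k hk => (breg_eq_mul_klFun (ha k hk) (hb k hk)).symm

/-- LOG-SUM FOR MIXTURES WITH COMMON NONNEGATIVE COEFFICIENTS: for `tₖ ≥ 0`, `pₖ ≥ 0`, `qₖ > 0`,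
`breg(Σ tₖ pₖ, Σ tₖ qₖ) ≤ Σ tₖ breg(pₖ, qₖ)` (terms with `tₖ = 0` drop out on both sides). -/
theorem breg_sum_smul_le {ι : Type*} (s : Finset ι) {t p q : ι → ℝ} (ht : ∀ k ∈ s, 0 ≤ t k)
    (hp : ∀ k ∈ s, 0 ≤ p k) (hq : ∀ k ∈ s, 0 < q k) :
    (∑ k ∈ s, t k * p k) * (log (∑ k ∈ s, t k * p k) - log (∑ k ∈ s, t k * q k)) - (∑ k ∈ s, t k * p k) +
        ∑ k ∈ s, t k * q k ≤
      ∑ k ∈ s, t k * (p k * (log (p k) - log (q k)) - p k + q k) := by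
  classical
  set s' := s.filter fun k => 0 < t k with hs'
  have hsub : s' ⊆ s := Finset.filter_subset _ _
  have hzero : ∀ k ∈ s, k ∉ s' → t k = 0 := by
    intro k hk hk'
    have : ¬0 < t k := fun h => hk' (Finset.mem_filter.2 ⟨hk, h⟩)
    exact le_antisymm (not_lt.1 this) (ht k hk)
  have e1 : ∑ k ∈ s, t k * p k = ∑ k ∈ s', t k * p k :=
    (Finset.sum_subset hsub fun k hk hk' => by rw [hzero k hk hk', zero_mul]).symm
  have e2 : ∑ k ∈ s, t k * q k = ∑ k ∈ s', t k * q k :=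
    (Finset.sum_subset hsub fun k hk hk' => by rw [hzero k hk hk', zero_mul]).symm
  have e3 : ∑ k ∈ s, t k * (p k * (log (p k) - log (q k)) - p k + q k) =
      ∑ k ∈ s', t k * (p k * (log (p k) - log (q k)) - p k + q k) :=
    (Finset.sum_subset hsub fun k hk hk' => by rw [hzero k hk hk', zero_mul]).symm
  rw [e1, e2, e3]
  have ht' : ∀ k ∈ s', 0 < t k := fun k hk => (Finset.mem_filter.1 hk).2
  calc (∑ k ∈ s', t k * p k) * (log (∑ k ∈ s', t k * p k) - log (∑ k ∈ s', t k * q k)) - (∑ k ∈ s', t k * p k) +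
        ∑ k ∈ s', t k * q k
      ≤ ∑ k ∈ s', (t k * p k * (log (t k * p k) - log (t k * q k)) - t k * p k + t k * q k) :=
        breg_sum_le s' (fun k hk => mul_nonneg (ht' k hk).le (hp k (hsub hk)))
          (fun k hk => mul_pos (ht' k hk) (hq k (hsub hk)))
    _ = ∑ k ∈ s', t k * (p k * (log (p k) - log (q k)) - p k + q k) :=
        Finset.sum_congr rfl fun k hk => breg_smul (ht' k hk).le (hp k (hsub hk)) (hq k (hsub hk))

/-- TWO-TERM LOG-SUM with a common first part: `breg(c + a, c + b) ≤ breg(a, b)` for `c, a ≥ 0`, `b > 0`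
(a common part only dilutes the divergence). -/
theorem breg_add_le {c a b : ℝ} (hc : 0 ≤ c) (ha : 0 ≤ a) (hb : 0 < b) :
    (c + a) * (log (c + a) - log (c + b)) - (c + a) + (c + b) ≤ a * (log a - log b) - a + b := by
  rcases hc.eq_or_lt with h0 | hcp
  · subst h0; simp
  have h := breg_sum_le (Finset.univ : Finset (Fin 2)) (a := ![c, a]) (b := ![c, b])
    (fun k _ => by fin_cases k <;> simp [hc, ha]) (fun k _ => by fin_cases k <;> simp [hcp, hb])
  simp only [Fin.sum_univ_two, Matrix.cons_val_zero, Matrix.cons_val_one] at h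
  linarith

/-- MIXTURE OF TWO: `breg(t₁p₁ + t₂p₂, t₁q₁ + t₂q₂) ≤ t₁ breg(p₁,q₁) + t₂ breg(p₂,q₂)`. -/
theorem breg_mix_two_le {t₁ t₂ p₁ p₂ q₁ q₂ : ℝ} (ht₁ : 0 ≤ t₁) (ht₂ : 0 ≤ t₂) (hp₁ : 0 ≤ p₁) (hp₂ : 0 ≤ p₂)
    (hq₁ : 0 < q₁) (hq₂ : 0 < q₂) :
    (t₁ * p₁ + t₂ * p₂) * (log (t₁ * p₁ + t₂ * p₂) - log (t₁ * q₁ + t₂ * q₂)) - (t₁ * p₁ + t₂ * p₂) +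
        (t₁ * q₁ + t₂ * q₂) ≤
      t₁ * (p₁ * (log p₁ - log q₁) - p₁ + q₁) + t₂ * (p₂ * (log p₂ - log q₂) - p₂ + q₂) := by
  have h := breg_sum_smul_le (Finset.univ : Finset (Fin 2)) (t := ![t₁, t₂]) (p := ![p₁, p₂]) (q := ![q₁, q₂])
    (fun k _ => by fin_cases k <;> simp [ht₁, ht₂]) (fun k _ => by fin_cases k <;> simp [hp₁, hp₂])
    (fun k _ => by fin_cases k <;> simp [hq₁, hq₂])
  simpa [Fin.sum_univ_two] using h

/-! ## Scalar facts for Gaussian relative entropies -/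

/-- `r − 1 − log r ≤ (r − 1)²/r` for `r > 0` (from `1 − 1/r ≤ log r`). -/
theorem sub_one_sub_log_le {r : ℝ} (hr : 0 < r) : r - 1 - log r ≤ (r - 1) ^ 2 / r := by
  have h := one_sub_inv_le_log_of_pos hr
  have e : (r - 1) ^ 2 / r = r - 2 + r⁻¹ := by field_simp; ring
  rw [e]; linarith

/-- PERTURBATIVE form: `r − 1 − log r ≤ 2 (r − 1)²` for `r ≥ 1/2`. -/
theorem sub_one_sub_log_le_two_sq {r : ℝ} (hr : 1 / 2 ≤ r) : r - 1 - log r ≤ 2 * (r - 1) ^ 2 := by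
  have hr0 : 0 < r := by linarith
  refine (sub_one_sub_log_le hr0).trans ?_
  rw [div_le_iff₀ hr0]
  nlinarith [sq_nonneg (r - 1)]

/-- NON-PERTURBATIVE form in terms of two temperatures: `s₁/s₀ − 1 − log (s₁/s₀) ≤ |s₁ − s₀| / min s₀ s₁`. -/
theorem ratio_sub_one_sub_log_le {s₀ s₁ : ℝ} (h₀ : 0 < s₀) (h₁ : 0 < s₁) :
    s₁ / s₀ - 1 - log (s₁ / s₀) ≤ |s₁ - s₀| / min s₀ s₁ := by
  have hr : 0 < s₁ / s₀ := div_pos h₁ h₀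
  refine (sub_one_sub_log_le hr).trans ?_
  have hm : 0 < min s₀ s₁ := lt_min h₀ h₁
  have e : (s₁ / s₀ - 1) ^ 2 / (s₁ / s₀) = (s₁ - s₀) ^ 2 / (s₀ * s₁) := by
    field_simp
  rw [e, div_le_div_iff₀ (mul_pos h₀ h₁) hm]
  have hsq : (s₁ - s₀) ^ 2 = |s₁ - s₀| * |s₁ - s₀| := by rw [← sq, sq_abs]
  rw [hsq, mul_assoc]
  refine mul_le_mul_of_nonneg_left ?_ (abs_nonneg _)
  rcases le_total s₀ s₁ with hle | hle
  · rw [min_eq_left hle, abs_of_nonneg (sub_nonneg.2 hle)]; nlinarith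
  · rw [min_eq_right hle, abs_of_nonpos (sub_nonpos.2 hle)]; nlinarith

end PerContact

/-- Registered anchor of this helper file (`--supports stmt-AtomisticToContinuum-14868`, helper of
`stub_perContact`): the log-sum (joint convexity) inequality of the Bregman divergence of `a log a`. -/
theorem bhPerContact_bregman_anchor : ∀ {ι : Type*} (s : Finset ι) (a b : ι → ℝ), (∀ k ∈ s, 0 ≤ a k) → (∀ k ∈ s, 0 < b k) → (∑ k ∈ s, a k) * (Real.log (∑ k ∈ s, a k) - Real.log (∑ k ∈ s, b k)) - (∑ k ∈ s, a k) + ∑ k ∈ s, b k ≤ ∑ k ∈ s, (a k * (Real.log (a k) - Real.log (b k)) - a k + b k) :=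
  fun s _ _ ha hb => PerContact.breg_sum_le s ha hb

end

end Summit.AtomisticToContinuum.HydrodynamicLimit.Theorems.BlockHDissipation
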